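import Summits.NavierStokesRegularity.NavierStokesRegularity.Theorems.PerpetualPumpAveragedTypeIBlowupPeakContinuity
import Summits.NavierStokesRegularity.NavierStokesRegularity.Theorems.PerpetualPumpAveragedTypeIBlowupWellposed

/-!
# Crux `PerpetualPump.AveragedTypeIBlowup` (stmt-NavierStokesRegularity-1835), line `Sketch`:
# stub `peakAt` — the renormalised amplitude of a step is continuous in the datum

This file proves the registered stub `stub_peakAt` of the line skeleton
`Cruxes/AveragedTypeIBlowup/Lines/Sketch.lean`, verbatim (tree vocabulary, let-free: the structure
constants `α`, the mode heat kernels `kern`, the critical variables `bvo, wvo`, the kernel majorants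
`M0o, M1o`, the constants `q, R, lad` and the solution class `Sol` of the exact Volterra chain are
bound variables pinned by defining equations; `val : ℝ → Fin 2 → ℤ → ℝ → ℝ` is a value function
assumed to agree with every solution from the datum `A` on its lifespan).

In the nested-interval shooting argument over the datum amplitude `A`, the renormalised amplitude of
step `k` is `β_k(A) := sup {b_k(A, t) : 0 ≤ t ≤ τ(A)}` with `b_k(A, ·) = bvo (val A) k` the `k`-th
carrier and `τ(A) := inf {t ≥ 0 : b_{k+1}(A, t) ≥ 1}` the first time the next carrier reaches `1`.
The stub: at a datum `A₀` whose solution `Y` (living on `[0, S)`) crosses `b_{k+1} = 1` strictly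
for the first time at `tc` (`b_{k+1} < 1` on `[0, tc)`, `= 1` at `tc`, `> 1` on `(tc, tc + δ]`,
`tc + δ < S`), `β_k` is continuous at `A₀` and equals `sup {b_k(Y, t) : 0 ≤ t ≤ tc}`.

Proof.
* `peakAt_persist`: the persistence half (ii) of the accepted `stub_wellposed`, rephrased in the
  `Sol` vocabulary — if `Sol A₁ S₁ Y₁` and `0 ≤ T < S₁`, every datum `A₂` near `A₁` has a solution
  `Sol A₂ S₂ Y₂` with `T < S₂`, `(1+ε₀)^{10n}|Y₁ - Y₂| ≤ L|A₁ - A₂|` on `[0, T]`.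
* `peakAt_val_near`: hence (through `val A = Y_A`) every carrier `t ↦ bvo (val A₁) n t` is continuous
  on `[0, T]` and `A ↦ bvo (val A) n t` is continuous at `A₁` uniformly in `t ∈ [0, T]`.
* `peakAt_continuousOn_uncurry`: continuity in `t` for each parameter plus locally uniform-in-`t`
  continuity in the parameter give joint continuity (an `ε/2` argument), on a closed rectangle
  `[A₀ - δ', A₀ + δ'] × [0, tc + δ']`, `δ' = min δ (δ₀/2)`.
* `stub_peakContinuity` (accepted) then gives the continuity at `A₀`, and `peakContinuity_sInf_eq`
  the value identity (`τ(A₀) = tc`, and `val A₀ = Y` on `[0, tc] ⊂ [0, S)`).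

## References

* T. Tao, *Finite time blowup for an averaged three-dimensional Navier–Stokes equation*, J. Amer.
  Math. Soc. 29 (2016), 601–674 = arXiv:1402.0290v3, §4 p. 22 (4.14), §5 (context; the lemma itself
  is folklore ODE/real analysis). [`Tao2016AveragedNS`]
-/

noncomputable section

-- the summit namespace `…NavierStokesRegularity.NavierStokesRegularity…` is the tree convention
set_option linter.dupNamespace false

open MeasureTheory Set Filter Topology
open scoped ENNReal
open Literature.Analysis.FluidPDE Literature.Analysis.FluidPDE.Tao2016
open Literature.Analysis.FluidPDE.TaoCascade (quadTerm)

namespace Summit.NavierStokesRegularity.NavierStokesRegularity.Theorems.PerpetualPumpAveragedTypeIBlowup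

/-! ### Joint continuity from continuity in each variable, one of them locally uniform -/

/-- **Joint continuity from separate continuity, uniform in one variable.** If `t ↦ f A t` is
continuous on `I` for every `A ∈ U`, and at every `A₁ ∈ U` the map `A ↦ f A t` is continuous
uniformly in `t ∈ I`, then `Function.uncurry f` is continuous on `U ×ˢ I`. [folklore] -/
theorem peakAt_continuousOn_uncurry {f : ℝ → ℝ → ℝ} {U I : Set ℝ}
    (hcont : ∀ A ∈ U, ContinuousOn (f A) I)
    (hunif : ∀ A₁ ∈ U, ∀ ε : ℝ, 0 < ε → ∃ δ₁ : ℝ, 0 < δ₁ ∧ ∀ A₂ : ℝ, |A₂ - A₁| < δ₁ →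
      ∀ t ∈ I, |f A₂ t - f A₁ t| < ε) :
    ContinuousOn (Function.uncurry f) (U ×ˢ I) := by
  rw [Metric.continuousOn_iff]
  rintro ⟨A₁, t₁⟩ ⟨hA₁, ht₁⟩ ε hε
  obtain ⟨δ₁, hδ₁, h₁⟩ := hunif A₁ hA₁ (ε / 2) (half_pos hε)
  obtain ⟨δ₂, hδ₂, h₂⟩ := Metric.continuousOn_iff.1 (hcont A₁ hA₁) t₁ ht₁ (ε / 2) (half_pos hε)
  refine ⟨min δ₁ δ₂, lt_min hδ₁ hδ₂, ?_⟩
  rintro ⟨A, t⟩ ⟨_, ht⟩ hd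
  rw [Prod.dist_eq, max_lt_iff] at hd
  have hdA : |A - A₁| < δ₁ := by
    have h := hd.1.trans_le (min_le_left _ _)
    rwa [Real.dist_eq] at h
  have hdt : dist t t₁ < δ₂ := hd.2.trans_le (min_le_right _ _)
  have h₃ : |f A₁ t - f A₁ t₁| < ε / 2 := by
    have h := h₂ t ht hdt
    rwa [Real.dist_eq] at h
  simp only [Function.uncurry_apply_pair, Real.dist_eq]
  calc |f A t - f A₁ t₁| ≤ |f A t - f A₁ t| + |f A₁ t - f A₁ t₁| := abs_sub_le _ _ _
    _ < ε / 2 + ε / 2 := add_lt_add (h₁ A hdA t ht) h₃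
    _ = ε := add_halves ε

/-! ### Persistence near a datum, in the `Sol` vocabulary -/

/-- **Persistence with Lipschitz dependence, in the vocabulary of the line** (`stub_wellposed` (ii)).
If `Y₁` is a solution of the exact Volterra chain from the datum `A₁` in the class `Sol` on `[0, S₁)`
and `0 ≤ T < S₁`, then there are `L` and `δ₁ > 0` such that every datum `A₂` with `|A₂ - A₁| < δ₁`
has a solution `Y₂` in the class on some `[0, S₂)` with `T < S₂` and
`(1+ε₀)^{10n}|Y₁ - Y₂| ≤ L|A₁ - A₂|` on `[0, T]`. [cite: Tao2016AveragedNS, §4 p. 22 (4.14)] -/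
theorem peakAt_persist {ε₀ : ℝ} (hε₀ : 0 < ε₀) (hε₁ : ε₀ ≤ 1) (𝒟 : CascadeWaveletData ε₀ 2)
    (α : Fin 2 → Fin 2 → Fin 2 → ℤ × ℤ × ℤ → ℝ) (kern : Fin 2 → ℤ → ℝ → ℝ)
    (Sol : ℝ → ℝ → (Fin 2 → ℤ → ℝ → ℝ) → Prop)
    (hkern : ∀ (i : Fin 2) (n : ℤ) (τ : ℝ),
      kern i n τ = (pairing (heat τ (cascadeWavelet ε₀ (𝒟.ψ i) n)) (cascadeWavelet ε₀ (𝒟.ψ i) n)).re)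
    (hSol : ∀ (A S : ℝ) (Y : Fin 2 → ℤ → ℝ → ℝ), Sol A S Y ↔
      (0 < S ∧ (∀ i n, ContinuousOn (Y i n) (Ico 0 S)) ∧ (∀ i n t, n < 0 → Y i n t = 0) ∧
      (∀ S' : ℝ, S' < S → ∃ C : ℝ, ∀ (i : Fin 2) (n : ℤ), ∀ t ∈ Icc 0 S',
        (1 + ε₀) ^ ((20 : ℝ) * n) * |Y i n t| ≤ C) ∧
      (∀ (i : Fin 2) (n : ℤ), ∀ t ∈ Ico 0 S,
        Y i n t = (if i = 0 ∧ n = 0 then A else 0) * kern i n t +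
          ∫ s in (0 : ℝ)..t, kern i n (t - s) * quadTerm ε₀ α Y i n s)))
    {A₁ S₁ T : ℝ} {Y₁ : Fin 2 → ℤ → ℝ → ℝ} (h₁ : Sol A₁ S₁ Y₁) (hT0 : 0 ≤ T) (hTS : T < S₁) :
    ∃ L δ₁ : ℝ, 0 < δ₁ ∧ ∀ A₂ : ℝ, |A₂ - A₁| < δ₁ →
      ∃ (S₂ : ℝ) (Y₂ : Fin 2 → ℤ → ℝ → ℝ), Sol A₂ S₂ Y₂ ∧ T < S₂ ∧
        ∀ (i : Fin 2) (n : ℤ), ∀ t ∈ Icc 0 T,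
          (1 + ε₀) ^ ((10 : ℝ) * n) * |Y₁ i n t - Y₂ i n t| ≤ L * |A₁ - A₂| := by
  have hL1 : 1 ≤ 1 + ε₀ := by linarith
  obtain ⟨-, hc, hlow, hdec, hchain⟩ := (hSol A₁ S₁ Y₁).1 h₁
  obtain ⟨C, hC⟩ := hdec T hTS
  -- the chain in kernel-explicit form
  have hchain' : ∀ (i : Fin 2) (n : ℤ), ∀ t ∈ Ico 0 S₁,
      Y₁ i n t = (if i = 0 ∧ n = 0 then A₁ else 0) *
          (pairing (heat t (cascadeWavelet ε₀ (𝒟.ψ i) n)) (cascadeWavelet ε₀ (𝒟.ψ i) n)).re +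
        ∫ s in (0 : ℝ)..t,
          (pairing (heat (t - s) (cascadeWavelet ε₀ (𝒟.ψ i) n)) (cascadeWavelet ε₀ (𝒟.ψ i) n)).re *
            quadTerm ε₀ α Y₁ i n s := by
    intro i n t ht
    simp only [← hkern]
    exact hchain i n t ht
  -- the (unused but required) weight-`10` bound on `[0, T]`
  have hC10 : ∀ (i : Fin 2) (n : ℤ), ∀ t ∈ Icc 0 T,
      (1 + ε₀) ^ ((10 : ℝ) * n) * |Y₁ i n t| ≤ max C 0 := by
    intro i n t ht
    rcases lt_or_ge n 0 with hn | hn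
    · rw [hlow i n t hn, abs_zero, mul_zero]
      exact le_max_right _ _
    · have hn' : (0 : ℝ) ≤ n := by exact_mod_cast hn
      calc (1 + ε₀) ^ ((10 : ℝ) * n) * |Y₁ i n t| ≤ (1 + ε₀) ^ ((20 : ℝ) * n) * |Y₁ i n t| :=
            mul_le_mul_of_nonneg_right
              (Real.rpow_le_rpow_of_exponent_le hL1 (by nlinarith)) (abs_nonneg _)
        _ ≤ max C 0 := (hC i n t ht).trans (le_max_left _ _)
  obtain ⟨L, δ₁, hδ₁, hA⟩ :=
    (stub_wellposed hε₀ hε₁ 𝒟 α 0 0).2 A₁ S₁ T (max C 0) Y₁ hT0 hTS hc hlow hdec hchain' hC10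
  refine ⟨L, δ₁, hδ₁, fun A₂ hA₂ => ?_⟩
  obtain ⟨S₂, Y₂, hTS₂, hc₂, hlow₂, hdec₂, hchain₂, hLip⟩ := hA A₂ hA₂
  refine ⟨S₂, Y₂, (hSol A₂ S₂ Y₂).2 ⟨hT0.trans_lt hTS₂, hc₂, hlow₂, hdec₂, fun i n t ht => ?_⟩,
    hTS₂, hLip⟩
  simp only [hkern]
  exact hchain₂ i n t ht

/-- **The carriers of the value function near a datum with a solution.** If `Sol A₁ S₁ Y₁` and
`0 ≤ T < S₁`, then (with `val A = Y_A` on the lifespan and `bvo Y n t = -(1+ε₀)^{n/2} Y 0 n t`):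
the carrier `t ↦ bvo (val A₁) n t` is continuous on `[0, T]`, and for every `ε > 0` all data `A₂`
near `A₁` have a solution living beyond `T` and `|bvo (val A₂) n t - bvo (val A₁) n t| < ε`
uniformly in `t ∈ [0, T]`. [cite: Tao2016AveragedNS, §4 p. 22 (4.14)] -/
theorem peakAt_val_near {ε₀ : ℝ} (hε₀ : 0 < ε₀) (hε₁ : ε₀ ≤ 1) (𝒟 : CascadeWaveletData ε₀ 2)
    (α : Fin 2 → Fin 2 → Fin 2 → ℤ × ℤ × ℤ → ℝ) (kern : Fin 2 → ℤ → ℝ → ℝ)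
    (bvo : (Fin 2 → ℤ → ℝ → ℝ) → ℤ → ℝ → ℝ) (Sol : ℝ → ℝ → (Fin 2 → ℤ → ℝ → ℝ) → Prop)
    (hkern : ∀ (i : Fin 2) (n : ℤ) (τ : ℝ),
      kern i n τ = (pairing (heat τ (cascadeWavelet ε₀ (𝒟.ψ i) n)) (cascadeWavelet ε₀ (𝒟.ψ i) n)).re)
    (hbvo : ∀ (Y : Fin 2 → ℤ → ℝ → ℝ) (n : ℤ) (t : ℝ),
      bvo Y n t = -((1 + ε₀) ^ ((n : ℝ) / 2) * Y 0 n t))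
    (hSol : ∀ (A S : ℝ) (Y : Fin 2 → ℤ → ℝ → ℝ), Sol A S Y ↔
      (0 < S ∧ (∀ i n, ContinuousOn (Y i n) (Ico 0 S)) ∧ (∀ i n t, n < 0 → Y i n t = 0) ∧
      (∀ S' : ℝ, S' < S → ∃ C : ℝ, ∀ (i : Fin 2) (n : ℤ), ∀ t ∈ Icc 0 S',
        (1 + ε₀) ^ ((20 : ℝ) * n) * |Y i n t| ≤ C) ∧
      (∀ (i : Fin 2) (n : ℤ), ∀ t ∈ Ico 0 S,
        Y i n t = (if i = 0 ∧ n = 0 then A else 0) * kern i n t +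
          ∫ s in (0 : ℝ)..t, kern i n (t - s) * quadTerm ε₀ α Y i n s)))
    (val : ℝ → Fin 2 → ℤ → ℝ → ℝ)
    (hval : ∀ (A S : ℝ) (Y : Fin 2 → ℤ → ℝ → ℝ), Sol A S Y →
      ∀ (i : Fin 2) (n : ℤ), ∀ t ∈ Ico 0 S, val A i n t = Y i n t)
    {A₁ S₁ T : ℝ} {Y₁ : Fin 2 → ℤ → ℝ → ℝ} (h₁ : Sol A₁ S₁ Y₁) (hT0 : 0 ≤ T) (hTS : T < S₁)
    (n : ℤ) :
    ContinuousOn (fun t => bvo (val A₁) n t) (Icc 0 T) ∧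
    ∀ ε : ℝ, 0 < ε → ∃ δ₁ : ℝ, 0 < δ₁ ∧ ∀ A₂ : ℝ, |A₂ - A₁| < δ₁ →
      (∃ (S₂ : ℝ) (Y₂ : Fin 2 → ℤ → ℝ → ℝ), Sol A₂ S₂ Y₂ ∧ T < S₂) ∧
      ∀ t ∈ Icc 0 T, |bvo (val A₂) n t - bvo (val A₁) n t| < ε := by
  have hL0 : 0 < 1 + ε₀ := by linarith
  obtain ⟨-, hc, -, -, -⟩ := (hSol A₁ S₁ Y₁).1 h₁
  have hIT : Icc 0 T ⊆ Ico 0 S₁ := fun t ht => ⟨ht.1, ht.2.trans_lt hTS⟩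
  have hv₁ : ∀ t ∈ Icc 0 T, val A₁ 0 n t = Y₁ 0 n t := fun t ht => hval A₁ S₁ Y₁ h₁ 0 n t (hIT ht)
  refine ⟨?_, fun ε hε => ?_⟩
  · have hY : ContinuousOn (fun t => -((1 + ε₀) ^ ((n : ℝ) / 2) * Y₁ 0 n t)) (Icc 0 T) :=
      (continuousOn_const.mul ((hc 0 n).mono hIT)).neg
    refine hY.congr fun t ht => ?_
    rw [hbvo, hv₁ t ht]
  · obtain ⟨L, δ₁, hδ₁, hA⟩ := peakAt_persist hε₀ hε₁ 𝒟 α kern Sol hkern hSol h₁ hT0 hTS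
    set K : ℝ := (1 + ε₀) ^ ((n : ℝ) / 2) * (1 + ε₀) ^ (-((10 : ℝ) * n)) * |L| + 1 with hK
    have hK0 : 0 < K := by positivity
    refine ⟨min δ₁ (ε / K), lt_min hδ₁ (div_pos hε hK0), fun A₂ hA₂ => ?_⟩
    obtain ⟨S₂, Y₂, h₂, hTS₂, hLip⟩ := hA A₂ (hA₂.trans_le (min_le_left _ _))
    refine ⟨⟨S₂, Y₂, h₂, hTS₂⟩, fun t ht => ?_⟩
    have hv₂ : val A₂ 0 n t = Y₂ 0 n t := hval A₂ S₂ Y₂ h₂ 0 n t ⟨ht.1, ht.2.trans_lt hTS₂⟩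
    rw [hbvo, hbvo, hv₁ t ht, hv₂]
    have h1 : |Y₁ 0 n t - Y₂ 0 n t| ≤ (1 + ε₀) ^ (-((10 : ℝ) * n)) * (|L| * |A₂ - A₁|) := by
      have h2 : (1 + ε₀) ^ (-((10 : ℝ) * n)) * ((1 + ε₀) ^ ((10 : ℝ) * n) * |Y₁ 0 n t - Y₂ 0 n t|) =
          |Y₁ 0 n t - Y₂ 0 n t| := by
        rw [← mul_assoc, ← Real.rpow_add hL0, neg_add_cancel, Real.rpow_zero, one_mul]
      rw [← h2]
      refine mul_le_mul_of_nonneg_left ((hLip 0 n t ht).trans ?_) (Real.rpow_nonneg hL0.le _)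
      rw [abs_sub_comm A₁ A₂]
      exact mul_le_mul_of_nonneg_right (le_abs_self L) (abs_nonneg _)
    have hA₂' : |A₂ - A₁| < ε / K := hA₂.trans_le (min_le_right _ _)
    calc |-((1 + ε₀) ^ ((n : ℝ) / 2) * Y₂ 0 n t) - -((1 + ε₀) ^ ((n : ℝ) / 2) * Y₁ 0 n t)|
        = (1 + ε₀) ^ ((n : ℝ) / 2) * |Y₁ 0 n t - Y₂ 0 n t| := by
          rw [show -((1 + ε₀) ^ ((n : ℝ) / 2) * Y₂ 0 n t) - -((1 + ε₀) ^ ((n : ℝ) / 2) * Y₁ 0 n t) =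
              (1 + ε₀) ^ ((n : ℝ) / 2) * (Y₁ 0 n t - Y₂ 0 n t) by ring, abs_mul,
            abs_of_pos (Real.rpow_pos_of_pos hL0 _)]
      _ ≤ (1 + ε₀) ^ ((n : ℝ) / 2) * ((1 + ε₀) ^ (-((10 : ℝ) * n)) * (|L| * |A₂ - A₁|)) :=
          mul_le_mul_of_nonneg_left h1 (Real.rpow_nonneg hL0.le _)
      _ = (K - 1) * |A₂ - A₁| := by rw [hK]; ring
      _ ≤ K * |A₂ - A₁| := mul_le_mul_of_nonneg_right (by linarith) (abs_nonneg _)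
      _ < K * (ε / K) := mul_lt_mul_of_pos_left hA₂' hK0
      _ = ε := mul_div_cancel₀ ε hK0.ne'

/-! ### The registered stub -/

/-- **Stub `peakAt`** (tree vocabulary + `stub_peakContinuity`). THE RENORMALISED AMPLITUDE OF A STEP IS
CONTINUOUS IN THE DATUM: with a value function `val A` that agrees with every solution from the datum `A` on
its lifespan (uniqueness, `chain_unique`), the amplitude `β_k(A) := sup {b_k(t) : 0 ≤ t ≤ τ(A)}`,
`τ(A) = inf {t ≥ 0 : b_{k+1}(t) ≥ 1}`, is continuous at every datum `A₀` whose solution crosses `b_{k+1} = 1`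
strictly for the first time at `tc` (joint continuity in `(A,t)` from the Lipschitz dependence of
`stub_wellposed` (ii), then `stub_peakContinuity`), and equals `sup {b_k(t) : 0 ≤ t ≤ tc}` there. [folklore] -/
theorem stub_peakAt :
    ∀ {ε₀ : ℝ}, 0 < ε₀ → ε₀ ≤ 1 / 20 → ∀ (𝒟 : CascadeWaveletData ε₀ 2) (r Dc εb : ℝ)
      (α : Fin 2 → Fin 2 → Fin 2 → ℤ × ℤ × ℤ → ℝ) (kern : Fin 2 → ℤ → ℝ → ℝ)
      (bvo wvo : (Fin 2 → ℤ → ℝ → ℝ) → ℤ → ℝ → ℝ) (M0o M1o : ℝ → (Fin 2 → ℤ → ℝ → ℝ) → ℤ → ℝ → ℝ)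
      (q : ℝ) (R : ℤ → ℝ) (lad : ℕ → ℝ) (Sol : ℝ → ℝ → (Fin 2 → ℤ → ℝ → ℝ) → Prop),
      0 < r → r ≤ (1 + ε₀ / 4) / 2 → (∀ i, 𝒟.radius i ≤ r ∧ ‖𝒟.center i‖ = 1 + ε₀ / 4) →
      Dc = 4 * Real.pi ^ 2 * ((1 + ε₀ / 4) ^ 2 + r ^ 2) → 0 < εb →
      α = (fun (i₁ i₂ i₃ : Fin 2) (μ : ℤ × ℤ × ℤ) =>
          if i₁ = 1 ∧ i₂ = 1 ∧ i₃ = 0 ∧ μ = (0, 0, 0) then Dc else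
          if i₁ = 1 ∧ i₂ = 0 ∧ i₃ = 1 ∧ μ = (0, 0, 0) then -Dc / 2 else
          if i₁ = 0 ∧ i₂ = 1 ∧ i₃ = 1 ∧ μ = (0, 0, 0) then -Dc / 2 else
          if i₁ = 1 ∧ i₂ = 0 ∧ i₃ = 1 ∧ μ = (0, 1, 0) then Dc / 2 else
          if i₁ = 0 ∧ i₂ = 1 ∧ i₃ = 1 ∧ μ = (1, 0, 0) then Dc / 2 else
          if i₁ = 1 ∧ i₂ = 1 ∧ i₃ = 0 ∧ μ = (0, 0, 1) then -Dc else
          if i₁ = 0 ∧ i₂ = 0 ∧ i₃ = 1 ∧ μ = (0, 0, 0) then εb * Dc else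
          if i₁ = 0 ∧ i₂ = 1 ∧ i₃ = 0 ∧ μ = (0, 0, 0) then -(εb * Dc) / 2 else
          if i₁ = 1 ∧ i₂ = 0 ∧ i₃ = 0 ∧ μ = (0, 0, 0) then -(εb * Dc) / 2 else 0) →
      (∀ (i : Fin 2) (n : ℤ) (τ : ℝ),
        kern i n τ = (pairing (heat τ (cascadeWavelet ε₀ (𝒟.ψ i) n)) (cascadeWavelet ε₀ (𝒟.ψ i) n)).re) →
      (∀ (Y : Fin 2 → ℤ → ℝ → ℝ) (n : ℤ) (t : ℝ), bvo Y n t = -((1 + ε₀) ^ ((n : ℝ) / 2) * Y 0 n t)) →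
      (∀ (Y : Fin 2 → ℤ → ℝ → ℝ) (n : ℤ) (t : ℝ), wvo Y n t = (1 + ε₀) ^ ((n : ℝ) / 2) * Y 1 n t) →
      (∀ (A : ℝ) (Y : Fin 2 → ℤ → ℝ → ℝ) (n : ℤ) (t : ℝ), M0o A Y n t = (1 + ε₀) ^ ((n : ℝ) / 2) *
        ((if n = 0 then |A| else 0) * (∫ ξ, Real.exp (-(heatRate ξ * t)) * modeWeight 𝒟 0 n ξ) +
          ∫ s in (0 : ℝ)..t, (∫ ξ, Real.exp (-(heatRate ξ * (t - s))) * modeWeight 𝒟 0 n ξ) *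
            |quadTerm ε₀ α Y 0 n s|)) →
      (∀ (A : ℝ) (Y : Fin 2 → ℤ → ℝ → ℝ) (n : ℤ) (t : ℝ), M1o A Y n t = (1 + ε₀) ^ ((n : ℝ) / 2) *
        ∫ s in (0 : ℝ)..t, (∫ ξ, Real.exp (-(heatRate ξ * (t - s))) * modeWeight 𝒟 1 n ξ) *
          |quadTerm ε₀ α Y 1 n s|) →
      q = Real.sqrt (1 + ε₀) → (∀ k : ℤ, R k = Dc * (1 + ε₀) ^ (2 * k)) →
      (∀ j : ℕ, lad j = εb * ((1 + ε₀) ^ (19 * (j - 2)))⁻¹) →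
      (∀ (A S : ℝ) (Y : Fin 2 → ℤ → ℝ → ℝ), Sol A S Y ↔
        (0 < S ∧ (∀ i n, ContinuousOn (Y i n) (Ico 0 S)) ∧ (∀ i n t, n < 0 → Y i n t = 0) ∧
        (∀ S' : ℝ, S' < S → ∃ C : ℝ, ∀ (i : Fin 2) (n : ℤ), ∀ t ∈ Icc 0 S',
          (1 + ε₀) ^ ((20 : ℝ) * n) * |Y i n t| ≤ C) ∧
        (∀ (i : Fin 2) (n : ℤ), ∀ t ∈ Ico 0 S,
          Y i n t = (if i = 0 ∧ n = 0 then A else 0) * kern i n t +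
            ∫ s in (0 : ℝ)..t, kern i n (t - s) * quadTerm ε₀ α Y i n s))) →
      ∀ (val : ℝ → Fin 2 → ℤ → ℝ → ℝ),
      (∀ (A S : ℝ) (Y : Fin 2 → ℤ → ℝ → ℝ), Sol A S Y → ∀ (i : Fin 2) (n : ℤ), ∀ t ∈ Ico 0 S, val A i n t = Y i n t) →
      ∀ (A₀ S tc δ : ℝ) (Y : Fin 2 → ℤ → ℝ → ℝ) (k : ℤ), Sol A₀ S Y → 0 < tc → 0 < δ → tc + δ < S →
      (∀ t ∈ Ico 0 tc, bvo Y (k + 1) t < 1) → bvo Y (k + 1) tc = 1 → (∀ t ∈ Ioc tc (tc + δ), 1 < bvo Y (k + 1) t) →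
      ContinuousAt (fun A => sSup ((fun t => bvo (val A) k t) '' Icc 0 (sInf {t : ℝ | 0 ≤ t ∧ 1 ≤ bvo (val A) (k + 1) t}))) A₀ ∧
      sSup ((fun t => bvo (val A₀) k t) '' Icc 0 (sInf {t : ℝ | 0 ≤ t ∧ 1 ≤ bvo (val A₀) (k + 1) t})) =
        sSup ((fun t => bvo Y k t) '' Icc 0 tc) := by
  intro ε₀ hε₀ hε₁ 𝒟 _r _Dc _εb α kern bvo _wvo _M0o _M1o _q _R _lad Sol _hr _hr2 _h𝒟 _hDc _hεb _hα hkern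
    hbvo _hwvo _hM0 _hM1 _hq _hR _hlad hSol val hval A₀ S tc δ Y k hY htc hδ hS hlt h1 hgt
  have hε₁' : ε₀ ≤ 1 := by linarith
  have hT0 : 0 ≤ tc + δ := by linarith
  -- the carriers of `val A₀` are those of `Y` on `[0, tc + δ] ⊂ [0, S)`
  have hv₀ : ∀ n : ℤ, ∀ t ∈ Icc 0 (tc + δ), bvo (val A₀) n t = bvo Y n t := by
    intro n t ht
    rw [hbvo, hbvo, hval A₀ S Y hY 0 n t ⟨ht.1, ht.2.trans_lt hS⟩]
  -- persistence: all data near `A₀` have a solution living beyond `tc + δ`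
  obtain ⟨δ₀, hδ₀, hP⟩ : ∃ δ₀ : ℝ, 0 < δ₀ ∧ ∀ A : ℝ, |A - A₀| < δ₀ →
      ∃ (S₂ : ℝ) (Y₂ : Fin 2 → ℤ → ℝ → ℝ), Sol A S₂ Y₂ ∧ tc + δ < S₂ := by
    obtain ⟨δ₀, hδ₀, hnear⟩ :=
      (peakAt_val_near hε₀ hε₁' 𝒟 α kern bvo Sol hkern hbvo hSol val hval hY hT0 hS k).2 1 one_pos
    exact ⟨δ₀, hδ₀, fun A hA => (hnear A hA).1⟩
  -- the closed rectangle `[A₀ - δ', A₀ + δ'] × [0, tc + δ']`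
  set δ' : ℝ := min δ (δ₀ / 2) with hδ'
  have hδ'0 : 0 < δ' := lt_min hδ (half_pos hδ₀)
  have hδ'δ : δ' ≤ δ := min_le_left _ _
  have hδ'₀ : δ' < δ₀ := (min_le_right _ _).trans_lt (half_lt_self hδ₀)
  have hU : ∀ A ∈ Icc (A₀ - δ') (A₀ + δ'), |A - A₀| < δ₀ := fun A hA =>
    lt_of_le_of_lt (abs_sub_le_iff.2 ⟨by linarith [hA.2], by linarith [hA.1]⟩) hδ'₀
  have hI : Icc 0 (tc + δ') ⊆ Icc 0 (tc + δ) := Icc_subset_Icc le_rfl (by linarith)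
  -- joint continuity of every carrier of the value function on the rectangle
  have hjoint : ∀ n : ℤ, ContinuousOn (Function.uncurry fun A t => bvo (val A) n t)
      (Icc (A₀ - δ') (A₀ + δ') ×ˢ Icc 0 (tc + δ')) := by
    intro n
    refine peakAt_continuousOn_uncurry (fun A hA => ?_) (fun A₁ hA₁ ε hε => ?_)
    · obtain ⟨S₂, Y₂, h₂, hTS₂⟩ := hP A (hU A hA)
      exact (peakAt_val_near hε₀ hε₁' 𝒟 α kern bvo Sol hkern hbvo hSol val hval h₂ hT0 hTS₂ n).1.mono
        hI
    · obtain ⟨S₂, Y₂, h₂, hTS₂⟩ := hP A₁ (hU A₁ hA₁)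
      obtain ⟨δ₁, hδ₁, hA⟩ :=
        (peakAt_val_near hε₀ hε₁' 𝒟 α kern bvo Sol hkern hbvo hSol val hval h₂ hT0 hTS₂ n).2 ε hε
      exact ⟨δ₁, hδ₁, fun A₂ hA₂ t ht => (hA A₂ hA₂).2 t (hI ht)⟩
  -- the first hitting time at `A₀` is `tc`
  have hτ : sInf {t : ℝ | 0 ≤ t ∧ 1 ≤ bvo (val A₀) (k + 1) t} = tc := by
    refine peakContinuity_sInf_eq htc.le ?_ fun t ht => ?_
    · rw [hv₀ (k + 1) tc ⟨htc.le, by linarith⟩, h1]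
    · rw [hv₀ (k + 1) t ⟨ht.1, by linarith [ht.2]⟩]
      exact hlt t ht
  refine ⟨?_, ?_⟩
  · refine stub_peakContinuity (fun A t => bvo (val A) k t) (fun A t => bvo (val A) (k + 1) t) A₀ tc
      δ' htc hδ'0 (hjoint k) (hjoint (k + 1)) (fun t ht => ?_) ?_ (fun t ht => ?_)
    · show bvo (val A₀) (k + 1) t < 1
      rw [hv₀ (k + 1) t ⟨ht.1, by linarith [ht.2]⟩]
      exact hlt t ht
    · show bvo (val A₀) (k + 1) tc = 1
      rw [hv₀ (k + 1) tc ⟨htc.le, by linarith⟩, h1]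
    · show 1 < bvo (val A₀) (k + 1) t
      rw [hv₀ (k + 1) t ⟨by linarith [ht.1], by linarith [ht.2]⟩]
      exact hgt t ⟨ht.1, by linarith [ht.2]⟩
  · rw [hτ, image_congr fun t ht => hv₀ k t ⟨ht.1, ht.2.trans (by linarith)⟩]

end Summit.NavierStokesRegularity.NavierStokesRegularity.Theorems.PerpetualPumpAveragedTypeIBlowup

end
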